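import Summits.QuantumFields.BalabanUV.T4Continuum.Support.TermwiseLocalLedger
import Summits.QuantumFields.BalabanUV.T4Continuum.Support.TermwiseLevelsProfile

/-!
# TermwiseLocalProfile — (U)(L) for `U(N)` Wilson terms PRODUCED from LEVEL-GRADED LOCAL regularity with a HÖLDER
oscillation profile (`ω_j ≤ 16L·α₁,j`, `α₁,j ≤ c_{α1}ε₁L^{−2(j+1)}·ϑ^j`): the `U(N)` producer of
`Support/TermwiseLocalLedger` re-typed for `β₀ < 1`

Cell `pub-balaban`, rung (B)+1 sub-cell t4, lineage `b2b-balaban-t4-ne7-p1` (node U5 = NE7, TERM-WISE member;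
generation 17), record `t4/T4-EST-NE7-P1.md` §23; companions `Support/TermwiseLocal(Binders|Ledger)`,
`Support/TermwiseLevelsProfile`.  HONEST FRAMING (page 1): FIXED FINITE T⁴, rung (B)+1, CONDITIONAL on BetaPertH and
the nine spine estimates (0/9 proved); NOT infinite volume, NOT a mass gap, NOT the Clay problem; NE7 NOT PRINTED in
[Balaban1984PropagatorsI]–[Balaban1989LargeFieldII], NOT proved here.  [folklore]; no definitions, no cite tags;
nothing printed is asserted.

WHAT IS PROVED ([folklore]).  §7 **`interpolation_averaging_UN_levels_profile`** —
`TermwiseLocal.interpolation_averaging_UN_levels` (Bałaban's concrete average (42) through `pker`/`PhiU`/`psiU`/`phiU`,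
`V = u(N)`, `e = eN`, `q₄ = N/24`, the LOCAL one-level binders `bch_PhiU_local` / `norm_phiU_le_window_local` /
`norm_phiU_le_local` / `norm_PhiU_sub_PhiU_local` on the window box `Δ(p′_y)` at the window's level) with the (44∇)
law re-typed to the PROFILE form `0 ≤ α₁,j ≤ c_{α1}ε₁L^{−2(j+1)}·ϑ^j`, `0 < ϑ < 1`, as ONE CALL of
`TermwiseLevels.interpolation_averaging_of_levels_profile`.  OUTPUT: generation 9's six binders with
`dU_K = #planes·(cOSC²ε₁²/4·windowSum ϑ² L⁴ (jlogOf Cl K) K + C₂·windowSum L⁻² L⁴ (jlogOf Cl K) K)`,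
`dL_K = #planes·C_L·windowSum L⁻² L⁴ (jlogOf Cl K) K`.  Binder census: as `TermwiseLocalLedger` §5 with `hα₁lev` in
profile form and `hϑ0 hϑ1`.  NOT DELIVERED: anything about print; NOT NE7, NOT summit progress.
-/

noncomputable section

open Finset MeasureTheory _root_.Filter _root_.Topology
open scoped BigOperators Matrix.Norms.L2Operator

namespace Summit.QuantumFields.BalabanUV.T4Continuum.TermwiseLocal

open Literature.MathematicalPhysics.QuantumFieldTheory.Balaban1983to89
open T4GoodClassBudget (windowSum jlogOf RecentOnly)
open T4TermwiseQuartic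
open T4TermwiseInstantiate (cBCH cBCH_nonneg rho_le_of_decay cSZ cSZ_nonneg half_of_smallness size_le_of_decay)
open T4TermwiseOscillation (cOSC)
open B7Prop1Explicit B7Prop2Explicit B7Prop1Local T4TermwiseBCH T4TermwiseTorus T4TermwiseUN T4TermwiseChainUN
open TermwiseLevels (interpolation_averaging_of_levels_profile)

/-! ## §7 (U)(L) for `U(N)` Wilson terms from LEVEL-GRADED LOCAL regularity with a HÖLDER oscillation profile -/

section CapstoneP
variable {n : Type*} [Fintype n] [DecidableEq n] [Nonempty n]
variable {ι : Type} {σ : Type*} [DecidableEq σ] {l₀ : ℝ} {T : ℕ → Finset σ} {Bad : ℕ → ℝ → Finset σ} {Adm : Set ι}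

/-- **(U)(L) FOR `U(N)` WILSON TERMS FROM LEVEL-GRADED LOCAL REGULARITY, HÖLDER PROFILE — ONE CALL of
`TermwiseLevels.interpolation_averaging_of_levels_profile`** (as `TermwiseLocal.interpolation_averaging_UN_levels`,
with the (44∇) law re-typed to `α₁,j ≤ c_{α1}ε₁L^{−2(j+1)}·ϑ^j`, `0 < ϑ < 1`, and the (U) variance share at rate
`ϑ²`) with generation 13's dictionary (`V = u(N)`, `e = eN`,
`q₄ = N/24`, `pbox`/`pker`/`phiU`/`psiU`/`PhiU`, `n₀ = #planes`, `vol = M⁴`, `c₁ = cSZ`, `c₂ = cOSC`, `c₃ = cBCH`) and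
the LEVEL-GRADED radii `sz_j = 2α_j`, `ω_j = 16L·α₁,j`, `ρb_j = 280(320L²α_j)²`: (wt)(ker)(cnt)(tr) discharged as in
generation 13; (bch) by `bch_PhiU_local`, (sz) by `norm_phiU_le_window_local` / `norm_phiU_le_local`, (osc-U) by
`norm_PhiU_sub_PhiU_local` — each from the LOCAL hypothesis on `Δ(p′_y)` AT THE WINDOW'S LEVEL.  REMAINING
hypotheses, BY NAME: level maps `lvlA lvlB lvlBf`, window clauses `hwinA hwinB hwinBf`, unitarity + periodicity +
LOCAL (44) `hA hB hBf`, LOCAL (44∇) `hAosc`, per-level smallness `hαlev` and decays `hdecay` `hα₁lev` ((B)/(B∇)-type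
INPUTS per level), (repr) `hreprU hreprL`, `hcα hε₁ hCl`, `2 ≤ M`, `2 ≤ L`, genuine planes.  OUTPUT: generation 9's
six binders with `dU_K = #planes·C_U·windowSum L⁻² L⁴ (jlogOf Cl K) K`, `dL_K = #planes·C_L·(same)`. [folklore] -/
theorem interpolation_averaging_UN_levels_profile {Y YA : Type*} {g : ℕ → ℝ → σ → ι → YA → ℝ}
    {f₁ : ℕ → ℝ → σ → ι → Y → ℝ} {Q : ℕ → ℝ → σ → ι → Y → YA} {yA yB : ℕ → ℝ → σ → ι → Y}
    {xA : ℕ → ℝ → σ → ι → YA}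
    (M L : ℕ) (hM : 2 ≤ M) (hL : 2 ≤ L) (planes : Finset (Fin 4 × Fin 4)) (hplanes : ∀ P ∈ planes, P.1 ≠ P.2)
    (VA VB : ℕ → ℝ → σ → ι → (B7Prop1Explicit.Site 4 → Fin 4 → (Matrix n n ℂ)ˣ))
    (lvlA lvlB lvlBf : ℕ → ℝ → σ → ι → (Fin 4 × Fin 4) × B7Prop1Explicit.Site 4 → ℕ)
    {αlev α₁lev : ℕ → ℝ} {cα cα₁ ε₁ Cl ϑ : ℝ}
    (hαlev : ∀ j, 0 ≤ αlev j ∧ 20480 * (L : ℝ) ^ 2 * αlev j ≤ 1)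
    (hA : ∀ K t, |t| ≤ l₀ → ∀ τ ∈ T K \ Bad K t, ∀ v ∈ Adm,
      (∀ x κ, VA K t τ v x κ ∈ unitaryUnits (Matrix n n ℂ)) ∧ IsPeriodic (M * L ^ K * L) (VA K t τ v) ∧
        ∀ y ∈ pbox planes (M * L ^ K), ∀ (x : B7Prop1Explicit.Site 4) (κ κ' : Fin 4), κ ≠ κ' →
          PlaqIn ((L : ℤ) • y.2) (deltaHi L ((L : ℤ) • y.2) y.1.1 y.1.2) (x, κ, κ') →
          ‖((hol (VA K t τ v) x (plaqWord κ κ') : (Matrix n n ℂ)ˣ) : Matrix n n ℂ) - 1‖ ≤ αlev (lvlA K t τ v y))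
    (hB : ∀ K t, |t| ≤ l₀ → ∀ τ ∈ T K \ Bad K t, ∀ v ∈ Adm,
      (∀ x κ, VB K t τ v x κ ∈ unitaryUnits (Matrix n n ℂ)) ∧ IsPeriodic (M * L ^ K * L) (VB K t τ v) ∧
        ∀ y ∈ pbox planes (M * L ^ K), ∀ (x : B7Prop1Explicit.Site 4) (κ κ' : Fin 4), κ ≠ κ' →
          PlaqIn ((L : ℤ) • y.2) (deltaHi L ((L : ℤ) • y.2) y.1.1 y.1.2) (x, κ, κ') →
          ‖((hol (VB K t τ v) x (plaqWord κ κ') : (Matrix n n ℂ)ˣ) : Matrix n n ℂ) - 1‖ ≤ αlev (lvlB K t τ v y))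
    (hBf : ∀ K t, |t| ≤ l₀ → ∀ τ ∈ T K \ Bad K t, ∀ v ∈ Adm, ∀ x ∈ pbox planes (M * L ^ K * L),
      ‖((hol (VB K t τ v) x.2 (plaqWord x.1.1 x.1.2) : (Matrix n n ℂ)ˣ) : Matrix n n ℂ) - 1‖ ≤ αlev (lvlBf K t τ v x))
    (hAosc : ∀ K t, |t| ≤ l₀ → ∀ τ ∈ T K \ Bad K t, ∀ v ∈ Adm, ∀ y ∈ pbox planes (M * L ^ K),
      ∀ (z : B7Prop1Explicit.Site 4) (κ : Fin 4), InBox ((L : ℤ) • y.2) (deltaHi L ((L : ℤ) • y.2) y.1.1 y.1.2) z →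
        InBox ((L : ℤ) • y.2) (deltaHi L ((L : ℤ) • y.2) y.1.1 y.1.2) (z + e κ) →
        ‖((VA K t τ v z κ : (Matrix n n ℂ)ˣ) : Matrix n n ℂ) * phiM (VA K t τ v) y.1 (z + e κ)
            * (((VA K t τ v z κ)⁻¹ : (Matrix n n ℂ)ˣ) : Matrix n n ℂ) - phiM (VA K t τ v) y.1 z‖
          ≤ α₁lev (lvlA K t τ v y))
    (hwinA : ∀ K t, |t| ≤ l₀ → ∀ τ ∈ T K \ Bad K t, ∀ v ∈ Adm,
      RecentOnly (pbox planes (M * L ^ K)) (lvlA K t τ v) (jlogOf Cl K) K)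
    (hwinB : ∀ K t, |t| ≤ l₀ → ∀ τ ∈ T K \ Bad K t, ∀ v ∈ Adm,
      RecentOnly (pbox planes (M * L ^ K)) (lvlB K t τ v) (jlogOf Cl K) K)
    (hwinBf : ∀ K t, |t| ≤ l₀ → ∀ τ ∈ T K \ Bad K t, ∀ v ∈ Adm,
      RecentOnly (pbox planes (M * L ^ K * L)) (lvlBf K t τ v) (jlogOf Cl K) K)
    (hcα : 0 ≤ cα) (hdecay : ∀ j, αlev j ≤ cα * ε₁ * (((L : ℝ) ^ j)⁻¹) ^ 2)
    (hα₁lev : ∀ j, 0 ≤ α₁lev j ∧ α₁lev j ≤ cα₁ * ε₁ * (((L : ℝ) ^ (j + 1))⁻¹) ^ 2 * ϑ ^ j)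
    (hreprU : ∀ K t, |t| ≤ l₀ → ∀ τ ∈ T K \ Bad K t, ∀ v ∈ Adm,
      f₁ K t τ v (yA K t τ v) = ∑ x ∈ pbox planes (M * L ^ K * L), eN (phiU (VA K t τ v) x) ∧
        g K t τ v (xA K t τ v) = ∑ y ∈ pbox planes (M * L ^ K), eN (psiU L (VA K t τ v) y))
    (hreprL : ∀ K t, |t| ≤ l₀ → ∀ τ ∈ T K \ Bad K t, ∀ v ∈ Adm,
      f₁ K t τ v (yB K t τ v) = ∑ x ∈ pbox planes (M * L ^ K * L), eN (phiU (VB K t τ v) x) ∧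
        g K t τ v (Q K t τ v (yB K t τ v)) = ∑ y ∈ pbox planes (M * L ^ K), eN (psiU L (VB K t τ v) y))
    (hε₁ : 0 ≤ ε₁) (hCl : 0 ≤ Cl) (hϑ0 : 0 < ϑ) (hϑ1 : ϑ < 1) :
    (∀ K t, |t| ≤ l₀ → ∀ τ ∈ T K \ Bad K t, ∀ v ∈ Adm,
      f₁ K t τ v (yA K t τ v) - g K t τ v (xA K t τ v)
        ≤ (M : ℝ) ^ 4 * ((planes.card : ℝ) * (cOSC L cα₁ ^ 2 * ε₁ ^ 2 / 4 * windowSum (ϑ ^ 2) ((L : ℝ) ^ 4) (jlogOf Cl K) K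
            + (cSZ L cα * cBCH L cα * ε₁ ^ 3 + (Fintype.card n : ℝ) / 24 * (cSZ L cα * ε₁ + cBCH L cα * ε₁ ^ 2) ^ 4)
              * windowSum (((L : ℝ) ^ 2)⁻¹) ((L : ℝ) ^ 4) (jlogOf Cl K) K))) ∧
    (∀ K t, |t| ≤ l₀ → ∀ τ ∈ T K \ Bad K t, ∀ v ∈ Adm,
      g K t τ v (Q K t τ v (yB K t τ v)) - f₁ K t τ v (yB K t τ v)
        ≤ (M : ℝ) ^ 4 * ((planes.card : ℝ) * (cSZ L cα * cBCH L cα * ε₁ ^ 3 + cBCH L cα ^ 2 * ε₁ ^ 4 / 2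
            + (Fintype.card n : ℝ) / 24 * (cSZ L cα ^ 4 * ε₁ ^ 4))
            * windowSum (((L : ℝ) ^ 2)⁻¹) ((L : ℝ) ^ 4) (jlogOf Cl K) K)) ∧
    (∀ K, 0 ≤ (planes.card : ℝ) * (cOSC L cα₁ ^ 2 * ε₁ ^ 2 / 4 * windowSum (ϑ ^ 2) ((L : ℝ) ^ 4) (jlogOf Cl K) K
        + (cSZ L cα * cBCH L cα * ε₁ ^ 3 + (Fintype.card n : ℝ) / 24 * (cSZ L cα * ε₁ + cBCH L cα * ε₁ ^ 2) ^ 4)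
          * windowSum (((L : ℝ) ^ 2)⁻¹) ((L : ℝ) ^ 4) (jlogOf Cl K) K)) ∧
    (∀ K, 0 ≤ (planes.card : ℝ) * (cSZ L cα * cBCH L cα * ε₁ ^ 3 + cBCH L cα ^ 2 * ε₁ ^ 4 / 2
        + (Fintype.card n : ℝ) / 24 * (cSZ L cα ^ 4 * ε₁ ^ 4))
        * windowSum (((L : ℝ) ^ 2)⁻¹) ((L : ℝ) ^ 4) (jlogOf Cl K) K) ∧
    Summable (fun K => (planes.card : ℝ) * (cOSC L cα₁ ^ 2 * ε₁ ^ 2 / 4 * windowSum (ϑ ^ 2) ((L : ℝ) ^ 4) (jlogOf Cl K) K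
        + (cSZ L cα * cBCH L cα * ε₁ ^ 3 + (Fintype.card n : ℝ) / 24 * (cSZ L cα * ε₁ + cBCH L cα * ε₁ ^ 2) ^ 4)
          * windowSum (((L : ℝ) ^ 2)⁻¹) ((L : ℝ) ^ 4) (jlogOf Cl K) K)) ∧
    Summable (fun K => (planes.card : ℝ) * (cSZ L cα * cBCH L cα * ε₁ ^ 3 + cBCH L cα ^ 2 * ε₁ ^ 4 / 2
        + (Fintype.card n : ℝ) / 24 * (cSZ L cα ^ 4 * ε₁ ^ 4))
        * windowSum (((L : ℝ) ^ 2)⁻¹) ((L : ℝ) ^ 4) (jlogOf Cl K) K) := by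
  have hM0 : 0 < M := by omega
  have hL0 : 0 < L := by omega
  have hL1 : 1 ≤ L := by omega
  have hLr : (1 : ℝ) < L := by exact_mod_cast (lt_of_lt_of_le one_lt_two hL)
  have h2L : ∀ K, 2 * L ≤ M * L ^ K * L := fun K =>
    Nat.mul_le_mul_right L (le_trans hM (Nat.le_mul_of_pos_right M (pow_pos hL0 K)))
  have hhalf : ∀ j, αlev j ≤ 1 / 2 := fun j => half_of_smallness hL1 (hαlev j).2
  obtain ⟨hw, hrow, hcol, hNf, hNc⟩ := kernel_tower_geometric M L hM0 hL0 planes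
  have hρ := rho_le_of_decay L (fun j => (hαlev j).1) hdecay
  have hω : ∀ j, 0 ≤ 4 * ((4 : ℕ) : ℝ) * (L : ℝ) * α₁lev j ∧
      4 * ((4 : ℕ) : ℝ) * (L : ℝ) * α₁lev j ≤ cOSC L cα₁ * ε₁ * (((L : ℝ) ^ (j + 1))⁻¹) ^ 2 * ϑ ^ j :=
    fun j => ⟨by have h0 := (hα₁lev j).1; positivity,
      calc 4 * ((4 : ℕ) : ℝ) * (L : ℝ) * α₁lev j = 16 * (L : ℝ) * α₁lev j := by push_cast; ring
        _ ≤ 16 * (L : ℝ) * (cα₁ * ε₁ * (((L : ℝ) ^ (j + 1))⁻¹) ^ 2 * ϑ ^ j) :=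
            mul_le_mul_of_nonneg_left (hα₁lev j).2 (by positivity)
        _ = cOSC L cα₁ * ε₁ * (((L : ℝ) ^ (j + 1))⁻¹) ^ 2 * ϑ ^ j := by unfold cOSC; ring⟩
  exact interpolation_averaging_of_levels_profile (V := ↥(uN n)) (e := eN) (q₄ := (Fintype.card n : ℝ) / 24)
    (vol := (M : ℝ) ^ 4) (n₀ := (planes.card : ℝ)) (c₁ := cSZ L cα) (c₂ := cOSC L cα₁) (c₃ := cBCH L cα)
    (sz := fun j => 2 * αlev j) (ω := fun j => 4 * ((4 : ℕ) : ℝ) * (L : ℝ) * α₁lev j)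
    (Pf := fun K => pbox planes (M * L ^ K * L)) (Pc := fun K => pbox planes (M * L ^ K))
    (w := fun K => pker (M * L ^ K * L) L)
    (φA := fun K t τ v x => phiU (VA K t τ v) x) (ψA := fun K t τ v y => psiU L (VA K t τ v) y)
    (ΦA := fun K t τ v y x => PhiU (M * L ^ K * L) L (VA K t τ v) y x)
    (φB := fun K t τ v x => phiU (VB K t τ v) x) (ψB := fun K t τ v y => psiU L (VB K t τ v) y)
    (ΦB := fun K t τ v y x => PhiU (M * L ^ K * L) L (VB K t τ v) y x)
    (lvlA := lvlA) (lvlB := lvlB) (lvlBf := lvlBf)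
    (ρb := fun j => 280 * (320 * (L : ℝ) ^ 2 * αlev j) ^ 2)
    eN_sandwich (by positivity) hLr hw hrow hcol (Nat.cast_nonneg _) (by positivity)
    (fun K => (hNf K).le) (fun K => (hNc K).le) hreprU
    (fun K t ht τ hτ v hv y _ x _ => norm_PhiU _ L (hA K t ht τ hτ v hv).1 (hA K t ht τ hτ v hv).2.1 y x)
    hwinA
    (fun K t ht τ hτ v hv y hy =>
      bch_PhiU_local _ L planes hplanes (hA K t ht τ hτ v hv).1 hL1 (h2L K) (hαlev _).1 (hαlev _).2 y
        (Finset.mem_product.1 hy).1 ((hA K t ht τ hτ v hv).2.2 y hy))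
    (fun K t ht τ hτ v hv y hy x _ hpos =>
      norm_phiU_le_window_local (hA K t ht τ hτ v hv).2.1 y x (hplanes y.1 (Finset.mem_product.1 hy).1) (hhalf _)
        (fun z hz => (hA K t ht τ hτ v hv).2.2 y hy z y.1.1 y.1.2 (hplanes y.1 (Finset.mem_product.1 hy).1) hz) hpos)
    (fun K t ht τ hτ v hv y hy x _ x' _ hpos hpos' =>
      norm_PhiU_sub_PhiU_local (M * L ^ K * L) L hL1 (hA K t ht τ hτ v hv).1 (hα₁lev _).1 y x x'
        (hplanes y.1 (Finset.mem_product.1 hy).1) (hAosc K t ht τ hτ v hv y hy) hpos hpos')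
    hreprL
    (fun K t ht τ hτ v hv y _ x _ => norm_PhiU _ L (hB K t ht τ hτ v hv).1 (hB K t ht τ hτ v hv).2.1 y x)
    hwinB hwinBf
    (fun K t ht τ hτ v hv y hy =>
      bch_PhiU_local _ L planes hplanes (hB K t ht τ hτ v hv).1 hL1 (h2L K) (hαlev _).1 (hαlev _).2 y
        (Finset.mem_product.1 hy).1 ((hB K t ht τ hτ v hv).2.2 y hy))
    (fun K t ht τ hτ v hv y hy x _ hpos =>
      norm_phiU_le_window_local (hB K t ht τ hτ v hv).2.1 y x (hplanes y.1 (Finset.mem_product.1 hy).1) (hhalf _)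
        (fun z hz => (hB K t ht τ hτ v hv).2.2 y hy z y.1.1 y.1.2 (hplanes y.1 (Finset.mem_product.1 hy).1) hz) hpos)
    (fun K t ht τ hτ v hv x hx => norm_phiU_le_local x (hhalf _) (hBf K t ht τ hτ v hv x hx))
    (cSZ_nonneg L hcα) (cBCH_nonneg L cα) hε₁ hCl hϑ0 hϑ1 (size_le_of_decay L hL1 (fun j => (hαlev j).1) hdecay)
    hω hρ

end CapstoneP

end Summit.QuantumFields.BalabanUV.T4Continuum.TermwiseLocal
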